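import Summits.HubbardSuperconductivity.HubbardSuperconductivity.Theorems.WidthHaldaneLeggettBound
import Summits.HubbardSuperconductivity.HubbardSuperconductivity.Theorems.WidthHaldaneTubeStepGauge

/-!
# Leggett's floors: every cut of a stiff tube carries kinetic energy, and the harmonic mean of the
# cut kinetic energies is at least `d₀·M`

Crux `WidthHaldaneBridge` (stmt-HubbardSuperconductivity-16311), line `Sketch` = card
`twist-transfer-floors` (skeleton registered 2026-08-17T11:02Z): its stubs `stub_cutFloor` and
`stub_leggettFloor`. Both are Leggett's variational bound `tubeEnergy_sub_le_profile`
(`Theorems/WidthHaldaneLeggettBound.lean`: `E(θ) - E(0) ≤ Σ_a (1 - cos φ_a)·k_a(ψ)` for EVERY column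
potential) at two profiles, combined with the stiffness floor `d₀ ≤ ρ̃_{L,M}` read as the energy
floor `d₀(π/3)²M/(2L) ≤ E(π/3) - E(0)`:

* ALL THE TWIST ON ONE CUT (step potential `Φ(j) = θ·[a ≤ j]`): `E(θ) - E(0) ≤ (1 - cos θ)·k_a(ψ)`
  (`tubeEnergy_sub_le_cut`), hence with `cos(π/3) = ½` the PER-CUT FLOOR
  `(π/3)²·d₀·M/L ≤ k_a(ψ)` (`cutFloor_of_stiffness`; no weak link anywhere, width-uniformly);
* THE OPTIMAL PROFILE `φ_a = θ·k_a⁻¹/Σ_j k_j⁻¹` (series resistors): with `1 - cos x ≤ x²/2`,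
  `E(θ) - E(0) ≤ θ²/(2Σ_a k_a⁻¹)`, hence LEGGETT'S HARMONIC-MEAN FLOOR `d₀·M·Σ_a k_a(ψ)⁻¹ ≤ L`
  (`leggettFloor_of_stiffness`).

Everything is PROVED (no definition, no named fact); `stub_cutFloor`, `stub_leggettFloor` are the
registered closed forms under `UniformThermo`.

References: A. J. Leggett, PRL 25 (1970) 1543; A. Paramekanti, N. Trivedi, M. Randeria, PRB 57 (1998)
11639, §IV (eqs. (var-bd), (kirchoff)); D. J. Scalapino, S. R. White, S. C. Zhang, PRB 47 (1993) 7995.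
-/

noncomputable section

namespace Summit.HubbardSuperconductivity.HubbardSuperconductivity.Theorems.WidthHaldane

set_option linter.dupNamespace false -- summit = problem name (single-conjunct summit), D-0017

open scoped BigOperators Classical Matrix ComplexConjugate
open Matrix Literature.MathematicalPhysics.QuantumLattice

section Floors

variable (L M : ℕ) [NeZero L] [NeZero M] (Λ : Type) [LinearOrder Λ] [Fintype Λ]
  (e : Λ ≃ ZMod L × ZMod M)

/-! ### `ZMod` bookkeeping for the step and the series-resistor potentials -/

omit [NeZero M] in
/-- `(−1 : ℤ/L).val + 1 = L`. [folklore] -/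
theorem val_neg_one_add_one : (-1 : ZMod L).val + 1 = L :=
  (zmod_eq_neg_one_iff_val (-1 : ZMod L)).1 rfl

omit [NeZero M] in
/-- **Increments of the step potential** `Φ(j) = θ·[a.val ≤ j.val]` (`a ≠ 0`, `L ≥ 2`): the bond phase
`Φ(j) - Φ(j-1) + θ·[j = 0]` is `θ` on the cut `a` and `0` on every other cut. [folklore] -/
theorem stepPotential_increment (hL : 2 ≤ L) {a : ZMod L} (ha : a ≠ 0) (θ : ℝ) (j : ZMod L) :
    ((if a.val ≤ j.val then θ else 0) - (if a.val ≤ (j - 1).val then θ else 0) +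
        if j = 0 then θ else 0) = if j = a then θ else 0 := by
  have ha1 : 1 ≤ a.val := Nat.one_le_iff_ne_zero.2 (fun h => ha ((ZMod.val_eq_zero a).1 h))
  have haL : a.val < L := ZMod.val_lt a
  by_cases hj : j = 0
  · subst hj
    have h1 : ¬ (a.val ≤ (0 : ZMod L).val) := by rw [ZMod.val_zero]; omega
    have h2 : a.val ≤ ((0 : ZMod L) - 1).val := by
      have := val_neg_one_add_one L
      rw [zero_sub]
      omega
    rw [if_neg h1, if_pos h2, if_pos rfl, if_neg (Ne.symm ha)]
    ring
  · have hv := val_sub_one_add_one L hL hj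
    have hiff : j = a ↔ j.val = a.val := (ZMod.val_injective L).eq_iff.symm
    rw [if_neg hj, add_zero]
    by_cases hja : j = a
    · rw [if_pos hja, if_pos (by rw [hja]), if_neg (by rw [hiff] at hja; omega)]
      ring
    · have hne : j.val ≠ a.val := fun h => hja (hiff.2 h)
      rw [if_neg hja]
      by_cases hle : a.val ≤ j.val
      · rw [if_pos hle, if_pos (by omega)]
        ring
      · rw [if_neg hle, if_neg (by omega)]
        ring

omit [NeZero M] in
/-- **Increments of the series-resistor potential** `Φ(j) = c·Σ_{a ≠ 0, a.val ≤ j.val} w_a` (`L ≥ 2`): the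
bond phase `Φ(j) - Φ(j-1) + θ·[j = 0]` equals `c·w_j` on every cut, provided `θ = c·Σ_a w_a` (the
flux is conserved). [folklore] -/
theorem resistorPotential_increment (hL : 2 ≤ L) (w : ZMod L → ℝ) (c θ : ℝ)
    (hθ : θ = c * ∑ a : ZMod L, w a) (j : ZMod L) :
    (c * ∑ a : ZMod L, (if a ≠ 0 ∧ a.val ≤ j.val then w a else 0)) -
        (c * ∑ a : ZMod L, (if a ≠ 0 ∧ a.val ≤ (j - 1).val then w a else 0)) +
        (if j = 0 then θ else 0) = c * w j := by
  by_cases hj : j = 0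
  · subst hj
    have h0 : ∀ a : ZMod L, (if a ≠ 0 ∧ a.val ≤ (0 : ZMod L).val then w a else 0) = 0 := by
      intro a
      rw [ZMod.val_zero]
      split_ifs with h
      · exact absurd ((ZMod.val_eq_zero a).1 (Nat.le_zero.1 h.2)) h.1
      · rfl
    have h1 : ∀ a : ZMod L, (if a ≠ 0 ∧ a.val ≤ (-1 : ZMod L).val then w a else 0) =
        w a - (if a = 0 then w a else 0) := by
      intro a
      have hle : a.val ≤ (-1 : ZMod L).val := by
        have := val_neg_one_add_one L
        have := ZMod.val_lt a
        omega
      by_cases ha : a = 0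
      · rw [if_neg (fun h => h.1 ha), if_pos ha, sub_self]
      · rw [if_pos ⟨ha, hle⟩, if_neg ha, sub_zero]
    simp only [h0, Finset.sum_const_zero, mul_zero, zero_sub, h1, Finset.sum_sub_distrib,
      Finset.sum_ite_eq', Finset.mem_univ, if_true]
    rw [hθ]
    ring
  · have hv := val_sub_one_add_one L hL hj
    have hpt : ∀ a : ZMod L, ((if a ≠ 0 ∧ a.val ≤ j.val then w a else 0) -
        (if a ≠ 0 ∧ a.val ≤ (j - 1).val then w a else 0)) = if a = j then w a else 0 := by
      intro a
      have hiff : a = j ↔ a.val = j.val := (ZMod.val_injective L).eq_iff.symm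
      by_cases ha : a = 0
      · have haj : a ≠ j := fun h => hj (h.symm.trans ha)
        rw [if_neg (fun h => h.1 ha), if_neg (fun h => h.1 ha), if_neg haj, sub_self]
      · by_cases haj : a = j
        · rw [if_pos ⟨ha, by rw [haj]⟩, if_neg (fun h => by rw [hiff] at haj; omega), if_pos haj, sub_zero]
        · have hne : a.val ≠ j.val := fun h => haj (hiff.2 h)
          rw [if_neg haj]
          by_cases hle : a.val ≤ j.val
          · rw [if_pos ⟨ha, hle⟩, if_pos ⟨ha, by omega⟩, sub_self]
          · rw [if_neg (fun h => hle h.2), if_neg (fun h => hle (by omega)), sub_self]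
    rw [if_neg hj, add_zero, ← mul_sub, ← Finset.sum_sub_distrib]
    simp only [hpt, Finset.sum_ite_eq', Finset.mem_univ, if_true]

/-! ### The stiffness floor as an energy floor -/

/-- `d₀ ≤ ρ̃_{L,M}(U,δ)` says `d₀(π/3)²M/(2L) ≤ E_{L,M}(U; π/3, N) - E_{L,M}(U; 0, N)`, `N = N_{L,M}(δ)`.
[cite: ScalapinoWhiteZhang1993, §II] -/
theorem energyFloor_of_stiffness {U δ d₀ : ℝ} (hd : d₀ ≤ tubeStiffness L M Λ e U δ) :
    d₀ * ((Real.pi / 3) ^ 2 * (M : ℝ)) / (2 * L) ≤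
      tubeEnergy L M Λ e U (Real.pi / 3) (tubeFilling L M δ) - tubeEnergy L M Λ e U 0 (tubeFilling L M δ) := by
  have hLr : (0 : ℝ) < L := by exact_mod_cast Nat.pos_of_ne_zero (NeZero.ne L)
  have hden : (0 : ℝ) < (Real.pi / 3) ^ 2 * (M : ℝ) := by
    have : (0 : ℝ) < M := by exact_mod_cast Nat.pos_of_ne_zero (NeZero.ne M)
    positivity
  rw [tubeStiffness_eq] at hd
  rw [div_le_iff₀ (by positivity)]
  have := (le_div_iff₀ hden).1 hd
  nlinarith

/-! ### All the twist on one cut -/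

/-- **All the twist on one cut** (`L ≥ 3`): for every cut `a`, every flux `θ` and every normalised
`(N, S^z = 0)` sector ground state `ψ`, `E(θ) - E(0) ≤ (1 - cos θ)·k_a(ψ)` (Leggett's bound at the step
potential). [cite: Leggett1970] -/
theorem tubeEnergy_sub_le_cut (hL : 3 ≤ L) (U θ : ℝ) (N : ℕ) {ψ : Fock (Orb Λ)}
    (h1 : star ψ ⬝ᵥ ψ = 1) (hgs : IsGroundStateInSector (tubeH0 L M Λ e U) N 0 ψ) (a : ZMod L) :
    tubeEnergy L M Λ e U θ N - tubeEnergy L M Λ e U 0 N ≤ (1 - Real.cos θ) * ∑ b : ZMod M, ∑ σ : Fin 2,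
        (expect (creation (orb (e.symm (a, b)) σ) * annihilation (orb (e.symm (a - 1, b)) σ) +
          creation (orb (e.symm (a - 1, b)) σ) * annihilation (orb (e.symm (a, b)) σ)) ψ).re := by
  by_cases ha : a = 0
  · subst ha
    have h := tubeEnergy_sub_le_profile L M Λ e hL (fun _ => (0 : ℝ)) U θ N h1 hgs
    refine h.trans (le_of_eq ?_)
    rw [Finset.sum_eq_single (0 : ZMod L)]
    · simp
    · intro j _ hj
      rw [if_neg hj]
      simp
    · exact fun h => absurd (Finset.mem_univ _) h
  · have h := tubeEnergy_sub_le_profile L M Λ e hL (fun j => if a.val ≤ j.val then θ else 0) U θ N h1 hgs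
    refine h.trans (le_of_eq ?_)
    simp only [stepPotential_increment L (by omega) ha θ]
    rw [Finset.sum_eq_single a]
    · rw [if_pos rfl]
    · intro j _ hj
      rw [if_neg hj, Real.cos_zero, sub_self, zero_mul]
    · exact fun h => absurd (Finset.mem_univ _) h

/-- **PER-CUT FLOOR** (`L ≥ 3`): if `d₀ ≤ ρ̃_{L,M}(U,δ)` then every cut of the tube carries, in EVERY
normalised `(N_{L,M}(δ), S^z = 0)` ground state, longitudinal kinetic energy
`k_a(ψ) ≥ (π/3)²·d₀·M/L` (`cos(π/3) = ½`): no weak link. [cite: Leggett1970] -/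
theorem cutFloor_of_stiffness (hL : 3 ≤ L) (U : ℝ) {δ d₀ : ℝ} (hd : d₀ ≤ tubeStiffness L M Λ e U δ)
    {ψ : Fock (Orb Λ)} (h1 : star ψ ⬝ᵥ ψ = 1)
    (hgs : IsGroundStateInSector (tubeH0 L M Λ e U) (tubeFilling L M δ) 0 ψ) (a : ZMod L) :
    (Real.pi / 3) ^ 2 * d₀ * (M : ℝ) / (L : ℝ) ≤ ∑ b : ZMod M, ∑ σ : Fin 2,
        (expect (creation (orb (e.symm (a, b)) σ) * annihilation (orb (e.symm (a - 1, b)) σ) +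
          creation (orb (e.symm (a - 1, b)) σ) * annihilation (orb (e.symm (a, b)) σ)) ψ).re := by
  have hLr : (0 : ℝ) < L := by exact_mod_cast (show 0 < L by omega)
  have hfloor := energyFloor_of_stiffness L M Λ e hd
  have hcut := tubeEnergy_sub_le_cut L M Λ e hL U (Real.pi / 3) (tubeFilling L M δ) h1 hgs a
  rw [Real.cos_pi_div_three] at hcut
  rw [div_le_iff₀ hLr]
  rw [div_le_iff₀ (by positivity)] at hfloor
  nlinarith

/-! ### The optimal profile: series resistors -/

/-- **LEGGETT'S HARMONIC-MEAN FLOOR** (`L ≥ 3`): if `d₀ ≤ ρ̃_{L,M}(U,δ)` and a normalised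
`(N_{L,M}(δ), S^z = 0)` ground state `ψ` has all its cut kinetic energies positive, then
`d₀·M·Σ_a k_a(ψ)⁻¹ ≤ L` (the series-resistor profile `φ_a = (π/3)·k_a⁻¹/Σ_j k_j⁻¹` in Leggett's bound,
`1 - cos x ≤ x²/2`). Leggett, PRL 25 (1970) 1543; Paramekanti–Trivedi–Randeria 1998 §IV eq. (kirchoff).
[cite: Leggett1970] -/
theorem leggettFloor_of_stiffness (hL : 3 ≤ L) (U : ℝ) {δ d₀ : ℝ} (hd : d₀ ≤ tubeStiffness L M Λ e U δ)
    {ψ : Fock (Orb Λ)} (h1 : star ψ ⬝ᵥ ψ = 1)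
    (hgs : IsGroundStateInSector (tubeH0 L M Λ e U) (tubeFilling L M δ) 0 ψ)
    (hk : ∀ a : ZMod L, 0 < ∑ b : ZMod M, ∑ σ : Fin 2,
        (expect (creation (orb (e.symm (a, b)) σ) * annihilation (orb (e.symm (a - 1, b)) σ) +
          creation (orb (e.symm (a - 1, b)) σ) * annihilation (orb (e.symm (a, b)) σ)) ψ).re) :
    d₀ * (M : ℝ) * ∑ a : ZMod L, (∑ b : ZMod M, ∑ σ : Fin 2,
        (expect (creation (orb (e.symm (a, b)) σ) * annihilation (orb (e.symm (a - 1, b)) σ) +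
          creation (orb (e.symm (a - 1, b)) σ) * annihilation (orb (e.symm (a, b)) σ)) ψ).re)⁻¹ ≤ (L : ℝ) := by
  set k : ZMod L → ℝ := fun a => ∑ b : ZMod M, ∑ σ : Fin 2,
        (expect (creation (orb (e.symm (a, b)) σ) * annihilation (orb (e.symm (a - 1, b)) σ) +
          creation (orb (e.symm (a - 1, b)) σ) * annihilation (orb (e.symm (a, b)) σ)) ψ).re with hkdef
  have hk' : ∀ a, 0 < k a := hk
  set S := ∑ a : ZMod L, (k a)⁻¹ with hS
  have hS0 : 0 < S := Finset.sum_pos (fun a _ => inv_pos.2 (hk' a)) Finset.univ_nonempty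
  have hLr : (0 : ℝ) < L := by exact_mod_cast (show 0 < L by omega)
  -- Leggett's bound at the series-resistor potential, `θ = π/3`, `c = θ/S`
  set θ : ℝ := Real.pi / 3 with hθ
  set c : ℝ := θ / S with hc
  have hθc : θ = c * ∑ a : ZMod L, (k a)⁻¹ := by rw [hc, ← hS]; field_simp
  have h := tubeEnergy_sub_le_profile L M Λ e hL
    (fun j => c * ∑ a : ZMod L, (if a ≠ 0 ∧ a.val ≤ j.val then (k a)⁻¹ else 0)) U θ
    (tubeFilling L M δ) h1 hgs
  simp only [resistorPotential_increment L (by omega) (fun a => (k a)⁻¹) c θ hθc] at h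
  -- `Σ_a (1 - cos(c k_a⁻¹)) k_a ≤ Σ_a (c k_a⁻¹)²/2 · k_a = c²S/2`
  have hbound : ∑ a : ZMod L, (1 - Real.cos (c * (k a)⁻¹)) * k a ≤ c ^ 2 * S / 2 := by
    calc ∑ a : ZMod L, (1 - Real.cos (c * (k a)⁻¹)) * k a
        ≤ ∑ a : ZMod L, (c * (k a)⁻¹) ^ 2 / 2 * k a := by
          refine Finset.sum_le_sum fun a _ => mul_le_mul_of_nonneg_right ?_ (hk' a).le
          have := two_sub_two_mul_cos_le_sq (c * (k a)⁻¹)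
          linarith
      _ = c ^ 2 / 2 * ∑ a : ZMod L, (k a)⁻¹ := by
          rw [Finset.mul_sum]
          refine Finset.sum_congr rfl fun a _ => ?_
          have hka : k a ≠ 0 := (hk' a).ne'
          field_simp
      _ = c ^ 2 * S / 2 := by rw [← hS]; ring
  have hfloor := energyFloor_of_stiffness L M Λ e hd
  -- chain: `d₀ θ² M/(2L) ≤ E(θ) - E(0) ≤ c² S/2 = θ²/(2S)`
  have hchain : d₀ * (θ ^ 2 * (M : ℝ)) / (2 * L) ≤ c ^ 2 * S / 2 := (hfloor.trans h).trans hbound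
  have hcS : c ^ 2 * S / 2 = θ ^ 2 / (2 * S) := by
    rw [hc]
    field_simp
  rw [hcS, div_le_div_iff₀ (by positivity) (by positivity)] at hchain
  -- `d₀ θ² M · 2S ≤ θ² · 2L`  ⇒  `d₀ M S ≤ L`
  have hθ2 : 0 < θ ^ 2 := by positivity
  have key : θ ^ 2 * (2 * (d₀ * (M : ℝ) * S)) ≤ θ ^ 2 * (2 * L) := by nlinarith
  have := le_of_mul_le_mul_left key hθ2
  linarith

end Floors

/-! ### Under the cruxes' hypothesis: the registered stubs -/

/-- **`stub_cutFloor`** (registered stub of crux stmt-HubbardSuperconductivity-16311, line `Sketch` /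
card `twist-transfer-floors`): under `UniformThermo` every cut of every admissible untwisted tube
carries `k_a(ψ) ≥ (π/3)²·d₀·M/L` in every normalised sector ground state. [cite: Leggett1970] -/
theorem stub_cutFloor : ∀ (U δ d₀ k₀ : ℝ) (M₁ L₀ : ℕ), 0 < d₀ → UniformThermo U δ d₀ k₀ M₁ L₀ → ∀ (L M : ℕ) [NeZero L] [NeZero M], Even L → Even M → M₁ ≤ M → M ≤ L → L₀ ≤ L → 3 ≤ L → ∀ (Λ : Type) [LinearOrder Λ] [Fintype Λ] (e : Λ ≃ ZMod L × ZMod M) (ψ : Fock (Orb Λ)), star ψ ⬝ᵥ ψ = 1 → IsGroundStateInSector (tubeH0 L M Λ e U) (tubeFilling L M δ) 0 ψ → ∀ a : ZMod L, (Real.pi / 3) ^ 2 * d₀ * (M : ℝ) / (L : ℝ) ≤ ∑ b : ZMod M, ∑ σ : Fin 2, (expect (creation (orb (e.symm (a, b)) σ) * annihilation (orb (e.symm (a - 1, b)) σ) + creation (orb (e.symm (a - 1, b)) σ) * annihilation (orb (e.symm (a, b)) σ)) ψ).re :=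
  fun U _δ _d₀ _k₀ _M₁ _L₀ _hd₀ h L M _ _ hLe hMe hM₁ hML hL₀ hL Λ _ _ e _ψ h1 hgs a =>
    cutFloor_of_stiffness L M Λ e hL U (h L M hLe hMe hM₁ hML hL₀ Λ e).1 h1 hgs a

/-- **`stub_leggettFloor`** (registered stub of crux stmt-HubbardSuperconductivity-16311, line `Sketch` /
card `twist-transfer-floors`): under `UniformThermo`, for every normalised sector ground state with
positive cut kinetic energies, `d₀·M·Σ_a k_a(ψ)⁻¹ ≤ L`. [cite: Leggett1970] -/
theorem stub_leggettFloor : ∀ (U δ d₀ k₀ : ℝ) (M₁ L₀ : ℕ), 0 < d₀ → UniformThermo U δ d₀ k₀ M₁ L₀ → ∀ (L M : ℕ) [NeZero L] [NeZero M], Even L → Even M → M₁ ≤ M → M ≤ L → L₀ ≤ L → 3 ≤ L → ∀ (Λ : Type) [LinearOrder Λ] [Fintype Λ] (e : Λ ≃ ZMod L × ZMod M) (ψ : Fock (Orb Λ)), star ψ ⬝ᵥ ψ = 1 → IsGroundStateInSector (tubeH0 L M Λ e U) (tubeFilling L M δ) 0 ψ → (∀ a : ZMod L, 0 < ∑ b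 : ZMod M, ∑ σ : Fin 2, (expect (creation (orb (e.symm (a, b)) σ) * annihilation (orb (e.symm (a - 1, b)) σ) + creation (orb (e.symm (a - 1, b)) σ) * annihilation (orb (e.symm (a, b)) σ)) ψ).re) → d₀ * (M : ℝ) * ∑ a : ZMod L, (∑ b : ZMod M, ∑ σ : Fin 2, (expect (creation (orb (e.symm (a, b)) σ) * annihilation (orb (e.symm (a - 1, b)) σ) + creation (orb (e.symm (a - 1, b)) σ) * annihilation (orb (e.symm (a, b)) σ)) ψ).re)⁻¹ ≤ (L : ℝ) :=
  fun U _δ _d₀ _k₀ _M₁ _L₀ _hd₀ h L M _ _ hLe hMe hM₁ hML hL₀ hL Λ _ _ e _ψ h1 hgs hk =>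
    leggettFloor_of_stiffness L M Λ e hL U (h L M hLe hMe hM₁ hML hL₀ Λ e).1 h1 hgs hk


end Summit.HubbardSuperconductivity.HubbardSuperconductivity.Theorems.WidthHaldane

end
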